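import Summits.QuantumFields.BalabanUV.Beta.GAN24.PerturbedEffectiveFormVolumeLimit

/-!
# `BalabanUV.Beta.GAN24.PerturbedEffectiveFormVolumeLimitInstances` — binder row G-an2-4 ∕ (CONV-C), routes R6 × R7 «TWO CURRENCIES», PART 154: THE EFFECTIVE FORM WITH BACKGROUND
# ON `ℤ^d` WITH NOTHING DISPLAYED — the eventually-pulled-back class (the torus samples of ONE `ℤ^d` datum, any behaviour on small volumes ∕ near the seam), the CONSTANT class (the
# effective form `Σ_k(u)` of a non-trivial constant connection `u·v` in the first-order model), and the packaged END with a positive coupling radius `∃ T > 0` from `(d, a, α, β)`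
# (PART 152's END; PART 124's admissible rate; the disc of PART 129 is non-empty by continuity at `T = 0`); and §2 the first DIAGRAM with background on `ℤ^d`: the one-loop bubble
# `Σ_k(u) ⊙ Σ_k(u)ᵀ` modulo EL₁ of `V_t` (unit b2b-balaban-gan24-p3, gen 55; v1)

NOT IN PRINT; OUR PROOF ([folklore] bookkeeping BY NAME over PART 152 (`conv_effFormPert_of_tendsto_background`, `tendsto_effFormPert_pair`), PART 148 (`lipschitzBackground_of_const`), PART 124
(`exists_admissible_rate`), PART 129 ∕ 130 ∕ 140 (§2), `CTAdmissibleRate.exists_pos_le_one_of_eventually`, `BalabanAveragedCoercive.gammaB_pos`; [Balaban1987RG1] (1.21)–(1.22) p. 264 LOCATE the shapes; nothing printed is a hypothesis).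
HONEST FRAMING (cell contract, verbatim): «discharging `BetaPertH` makes Bałaban's UV stability UNCONDITIONAL — a real constructive-QFT result; it is NOT the
continuum limit and NOT the Clay problem.»  HONEST DEPENDENCY (verbatim): «continuum YM on T⁴ ⇐ BetaPertH ∧ nine spine estimates (0/9 proved); BetaPertH ⇐
(D1) ∧ (D4) ∧ CAP+tail; G-an2-4 gates asym, D1 and NE2/3/4.»

WHAT THIS FILE PROVES (0 sorry, 0 `def`; hypotheses `d ≥ 3`, `L ≥ 2`, `a > 0`, `μ ≠ ν`, even cubic volumes, PART 129's coupling disc, `‖u‖ ≤ T`, any regulator `a″`):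
* **`conv_effFormPert_of_eventually_pullback`** — PART 152's END with NO limit hypothesis for every volume-indexed Lipschitz family (`α, β` uniform) whose reading at each fixed level,
  direction, component and fine integer point is eventually the value of ONE `ℤ^d` datum `v`.
* **`conv_effFormPert_constBackground`** — the END for the constant background `V_t k μ ≡ v_μ` (`(α, β) = (Σ_μ‖v_μ‖, 0)`), NOTHING displayed.
* `exists_couplingRadius` (`∃ T > 0` with `Tκ₀ ≤ 1∕2`, `Tκ_c ≤ 1∕2`, `4Tκ₀C ≤ γ`), **`conv_effFormPert_small`** — `∃ T > 0` (from `(d, a, α, β)`) such that PART 152's END holds for every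
  volume-indexed Lipschitz family `(α, β)` with EL₁, every `‖u‖ ≤ T` and every `a″`.
* §2 **`conv_bubble_effFormPert_of_tendsto_background`** — the one-loop Hadamard bubble `Σ_k(u) ⊙ Σ_k(u)ᵀ` WITH background has PART 152's END modulo EL₁ of `V_t` (PART 130's Hadamard ∕
  transpose closure on PART 129's (UD)+(SR); PART 152's EL₂): the diagram algebra of PARTs 140–141 carries over to `U ≠ 1`.
WHAT IT DOES NOT DO: large couplings; Bałaban's shaped `P_B`; `d ≤ 2` ∕ odd volumes; identify `Π_∞`.  SUPPLIER work; NEVER «G-an2-4 closed»; NOT (CONV-C), NOT D1, NOT `BetaPertH`,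
NOT continuum, NOT Clay.  Records: `HOME/b2b-balaban-gan24-p3/gen55/README.md`.
-/

noncomputable section

open scoped BigOperators ComplexConjugate Matrix Matrix.Norms.L2Operator
open Filter Topology

namespace Summit.QuantumFields.BalabanUV.Beta.GAN24.PerturbedEffectiveFormVolumeLimitInstances

open Literature.MathematicalPhysics.QuantumFieldTheory.Balaban1983to89
open Literature.MathematicalPhysics.QuantumFieldTheory.Balaban1983to89.B5Prop11Plancherel (Tor fine Cst)
open Literature.MathematicalPhysics.QuantumFieldTheory.Balaban1983to89.B5G183RateUnitTower (lev)
open Literature.MathematicalPhysics.QuantumFieldTheory.Balaban1983to89.B12Sec2to5 (betaPrime510)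
open Literature.MathematicalPhysics.QuantumFieldTheory.Balaban1983to89.Beta (Site IsInfiniteVolumeLimit)
open Literature.MathematicalPhysics.QuantumFieldTheory.Balaban1983to89.Beta.FreeLegDictionary (cubic)
open Literature.MathematicalPhysics.QuantumFieldTheory.Balaban1983to89.Beta.BlockKernelVolumeSockets (evenPeriod tendsto_evenPeriod)
open Literature.MathematicalPhysics.QuantumFieldTheory.Balaban1983to89.Beta.VectorTails (castT)
open Literature.MathematicalPhysics.QuantumFieldTheory.Balaban1983to89.Beta.LimitRate (StepRate limKernelOf KernelInputs)
open Summit.QuantumFields.BalabanUV.T4Continuum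
open Summit.QuantumFields.BalabanUV.T4Continuum.CovariantAveragingTower (avgTow)
open Summit.QuantumFields.BalabanUV.T4Continuum.BalabanAveragedTowerUnit (idx QBlev)
open Summit.QuantumFields.BalabanUV.T4Continuum.BalabanAveragedCoercive (gammaB gammaB_pos)
open Summit.QuantumFields.BalabanUV.T4Continuum.BalabanAveragedCoerciveTower (unitIdx)
open Summit.QuantumFields.BalabanUV.T4Continuum.KingPairingPlantedLaw (calDalev)
open Summit.QuantumFields.BalabanUV.T4Continuum.FirstOrderBackgroundModel (LipschitzBackground Pmodel)
open Summit.QuantumFields.BalabanUV.T4Continuum.CTConjugatedHbd (G2)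
open Summit.QuantumFields.BalabanUV.T4Continuum.CTAdmissibleRate (exists_pos_le_one_of_eventually)
open Summit.QuantumFields.BalabanUV.T4Continuum.DirichletRegionTower (gamD)
open Summit.QuantumFields.BalabanUV.T4Continuum.ScalarAveragedPropagator (gammaPs)
open Summit.QuantumFields.BalabanUV.T4Continuum.ScalarAveragedCompression (sigma0)
open Summit.QuantumFields.BalabanUV.T4Continuum.CTScalarGreen (Jfree)
open Summit.QuantumFields.BalabanUV.T4Continuum.CTGaugeTerm (deltaK)
open Summit.QuantumFields.BalabanUV.T4Continuum.CTVectorPropagator (JA)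
open Summit.QuantumFields.BalabanUV.T4Continuum.CTKingTowerWeights (distK distK_comm)
open Summit.QuantumFields.BalabanUV.T4Continuum.DecayRateInterpolation (EntryDecay TwoLevelDecayRate entryDecay_sub)
open Summit.QuantumFields.BalabanUV.Beta.GAN24.InsertionChainDecay (exists_admissible_rate)
open Summit.QuantumFields.BalabanUV.Beta.GAN24.EffectiveFormDecayBackground (exists_decay_inv_pertCov_QB twoLevelDecayRate_effForm_perturbed)
open Summit.QuantumFields.BalabanUV.Beta.GAN24.UnitLatticeDecayAlgebra (distK_nonneg distK_self entryDecay_smul entryDecay_one)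
open Summit.QuantumFields.BalabanUV.Beta.GAN24.EffectiveFormDecay (entryDecay_of_le_rate)
open Summit.QuantumFields.BalabanUV.Beta.GAN24.DiagramDecayAlgebra (twoLevelDecayRate_of_le_rate entryDecay_hadamard twoLevelDecayRate_hadamard entryDecay_transpose twoLevelDecayRate_transpose)
open Summit.QuantumFields.BalabanUV.Beta.GAN24.DiagramVolumeLimit (conv_of_decay_of_tendsto)
open Summit.QuantumFields.BalabanUV.Beta.GAN24.PerturbedEffectiveFormVolumeLimit (conv_effFormPert_of_tendsto_background tendsto_effFormPert_pair)

variable {d : ℕ} (L : ℕ) [NeZero L] (a : ℝ) (ha : 0 < a)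

/-! ## §1 Instances with nothing displayed: eventually-pulled-back and constant backgrounds; the disc is non-empty -/

/-- **`conv_effFormPert_of_eventually_pullback`** [our proof]: §4's END with NO limit hypothesis for every volume-indexed Lipschitz family whose reading at each fixed level, direction,
component and fine integer point is eventually the value of ONE `ℤ^d` datum `v`. [cite: Balaban1987RG1, (1.21)–(1.22) p.264 (shapes)] -/
theorem conv_effFormPert_of_eventually_pullback (hL : 2 ≤ L) (hd : 3 ≤ d) {μ ν : Fin d} (hne : μ ≠ ν) {α β a' κ T : ℝ} (ha' : 0 < a') (hκ0 : 0 < κ)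
    (hγ' : Jfree d a' κ 1 < gammaPs d a') (hδ' : deltaK d a' κ 1 < sigma0 d a' ^ 2) (hJA : JA d a a' κ 1 < gamD d a) (hT0 : 0 ≤ T)
    (hT₁ : T * (d * (α + β) * Cst d a) ≤ 1 / 2)
    (hT₂ : T * (d * (α * G2 d a (max (JA d a a' κ 1) 0) (gamD d a - max (JA d a a' κ 1) 0) κ)) ≤ 1 / 2)
    (hT₃ : 4 * T * (d * (α + β) * Cst d a) * Cst d a ≤ gammaB d a)
    {V : (t : ℕ) → (k : ℕ) → Fin d → (idx L (cubic d (evenPeriod t)) k → ℂ)} (hV : ∀ t, LipschitzBackground L (cubic d (evenPeriod t)) (V t) α β)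
    (v : ℕ → Fin d → (Fin d → ℤ) → Fin d → ℂ)
    (hpull : ∀ k (μ f : Fin d) (z : Fin d → ℤ), ∀ᶠ t in atTop, V t k μ (castT (cubic d (lev L k * evenPeriod t)) z, f) = v k μ z f)
    {u : ℂ} (hu : ‖u‖ ≤ T) (a'' : ℂ) :
    ∃ δ₀ B B' : ℝ, 0 < δ₀ ∧ 0 ≤ B ∧ 0 ≤ B' ∧ ∃ Pinf : ℕ → B12Beta.Kernel d,
      (∀ k, IsInfiniteVolumeLimit evenPeriod
        (fun t μ' ν' (z : Site d (evenPeriod t)) => (((avgTow (QBlev L (cubic d (evenPeriod t))) ((L : ℝ) ^ d)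
            (fun k' => (calDalev L (cubic d (evenPeriod t)) a ha k' + u • Pmodel L (cubic d (evenPeriod t)) (V t) k')⁻¹) k)⁻¹
            - a'' • (1 : Matrix (idx L (cubic d (evenPeriod t)) 0) (idx L (cubic d (evenPeriod t)) 0) ℂ))
          ((unitIdx L (cubic d (evenPeriod t))).symm (z, μ')) ((unitIdx L (cubic d (evenPeriod t))).symm (0, ν'))).re) (Pinf k)) ∧
      Beta.LimitRate.UniformDecay Pinf μ ν B (δ₀ / d) ∧ StepRate Pinf μ ν B' (δ₀ / d) (Real.sqrt ((L : ℝ)⁻¹)) ∧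
      (∃ K : KernelInputs d Pinf, K.θ = Real.sqrt ((L : ℝ)⁻¹) ∧ K.c₀ = betaPrime510 d (B' / (1 - Real.sqrt ((L : ℝ)⁻¹))) (δ₀ / d) ∧ K.Pinf = limKernelOf Pinf ∧ K.μ = μ ∧ K.ν = ν) ∧
      (∀ k, |B12Beta.secondMoment (Pinf k) μ ν - B12Beta.secondMoment (limKernelOf Pinf) μ ν|
          ≤ betaPrime510 d (B' / (1 - Real.sqrt ((L : ℝ)⁻¹))) (δ₀ / d) * Real.sqrt ((L : ℝ)⁻¹) ^ k) :=
  conv_effFormPert_of_tendsto_background L a ha hL hd hne ha' hκ0 hγ' hδ' hJA hT0 hT₁ hT₂ hT₃ hV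
    (fun k μ f z => ⟨v k μ z f, tendsto_const_nhds.congr' ((hpull k μ f z).mono fun _ ht => ht.symm)⟩) hu a''

/-- **`conv_effFormPert_constBackground` — THE EFFECTIVE FORM OF A CONSTANT NON-TRIVIAL CONNECTION ON `ℤ^d`, NOTHING DISPLAYED** [our proof] (`d ≥ 3`, `L ≥ 2`, `a > 0`, `μ ≠ ν`, even
cubic volumes; PART 129's disc with `(α, β) = (Σ_μ‖v_μ‖, 0)`; `‖u‖ ≤ T`; any `a″`): for the constant background `V_t k μ ≡ v_μ` the tower `Σ_k(u)` has §4's END with no hypothesis on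
the background. [cite: Balaban1987RG1, (1.21)–(1.22) p.264 (shapes)] -/
theorem conv_effFormPert_constBackground (hL : 2 ≤ L) (hd : 3 ≤ d) {μ ν : Fin d} (hne : μ ≠ ν) (v : Fin d → ℂ) {a' κ T : ℝ} (ha' : 0 < a') (hκ0 : 0 < κ)
    (hγ' : Jfree d a' κ 1 < gammaPs d a') (hδ' : deltaK d a' κ 1 < sigma0 d a' ^ 2) (hJA : JA d a a' κ 1 < gamD d a) (hT0 : 0 ≤ T)
    (hT₁ : T * (d * ((∑ μ, ‖v μ‖) + 0) * Cst d a) ≤ 1 / 2)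
    (hT₂ : T * (d * ((∑ μ, ‖v μ‖) * G2 d a (max (JA d a a' κ 1) 0) (gamD d a - max (JA d a a' κ 1) 0) κ)) ≤ 1 / 2)
    (hT₃ : 4 * T * (d * ((∑ μ, ‖v μ‖) + 0) * Cst d a) * Cst d a ≤ gammaB d a)
    (V : (t : ℕ) → (k : ℕ) → Fin d → (idx L (cubic d (evenPeriod t)) k → ℂ)) (hV : ∀ t k μ i, V t k μ i = v μ) {u : ℂ} (hu : ‖u‖ ≤ T) (a'' : ℂ) :
    ∃ δ₀ B B' : ℝ, 0 < δ₀ ∧ 0 ≤ B ∧ 0 ≤ B' ∧ ∃ Pinf : ℕ → B12Beta.Kernel d,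
      (∀ k, IsInfiniteVolumeLimit evenPeriod
        (fun t μ' ν' (z : Site d (evenPeriod t)) => (((avgTow (QBlev L (cubic d (evenPeriod t))) ((L : ℝ) ^ d)
            (fun k' => (calDalev L (cubic d (evenPeriod t)) a ha k' + u • Pmodel L (cubic d (evenPeriod t)) (V t) k')⁻¹) k)⁻¹
            - a'' • (1 : Matrix (idx L (cubic d (evenPeriod t)) 0) (idx L (cubic d (evenPeriod t)) 0) ℂ))
          ((unitIdx L (cubic d (evenPeriod t))).symm (z, μ')) ((unitIdx L (cubic d (evenPeriod t))).symm (0, ν'))).re) (Pinf k)) ∧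
      Beta.LimitRate.UniformDecay Pinf μ ν B (δ₀ / d) ∧ StepRate Pinf μ ν B' (δ₀ / d) (Real.sqrt ((L : ℝ)⁻¹)) ∧
      (∃ K : KernelInputs d Pinf, K.θ = Real.sqrt ((L : ℝ)⁻¹) ∧ K.c₀ = betaPrime510 d (B' / (1 - Real.sqrt ((L : ℝ)⁻¹))) (δ₀ / d) ∧ K.Pinf = limKernelOf Pinf ∧ K.μ = μ ∧ K.ν = ν) ∧
      (∀ k, |B12Beta.secondMoment (Pinf k) μ ν - B12Beta.secondMoment (limKernelOf Pinf) μ ν|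
          ≤ betaPrime510 d (B' / (1 - Real.sqrt ((L : ℝ)⁻¹))) (δ₀ / d) * Real.sqrt ((L : ℝ)⁻¹) ^ k) := by
  have hα : ∀ μ, ‖v μ‖ ≤ ∑ μ, ‖v μ‖ := fun μ => Finset.single_le_sum (fun μ _ => norm_nonneg (v μ)) (Finset.mem_univ μ)
  exact conv_effFormPert_of_eventually_pullback L a ha hL hd hne ha' hκ0 hγ' hδ' hJA hT0 hT₁ hT₂ hT₃
    (fun t => ConstantBackgroundVolumeLimit.lipschitzBackground_of_const L (cubic d (evenPeriod t)) (Finset.sum_nonneg fun μ _ => norm_nonneg (v μ)) hα (V t) (hV t))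
    (fun _ μ _ _ => v μ) (fun k μ f z => Eventually.of_forall fun t => hV t k μ _) hu a''

omit [NeZero L] in
/-- **the coupling disc is non-empty**: for nonnegative letters `κ₀, κ_c, C` and `γ > 0` there is `T > 0` with `Tκ₀ ≤ 1∕2`, `Tκ_c ≤ 1∕2`, `4Tκ₀C ≤ γ` (continuity at `T = 0`). [folklore] -/
theorem exists_couplingRadius {κ₀ κc C γ : ℝ} (hγ : 0 < γ) :
    ∃ T : ℝ, 0 < T ∧ T * κ₀ ≤ 1 / 2 ∧ T * κc ≤ 1 / 2 ∧ 4 * T * κ₀ * C ≤ γ := by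
  have hev : ∀ᶠ T : ℝ in 𝓝 0, (T * κ₀ < 1 / 2 ∧ T * κc < 1 / 2) ∧ 4 * T * κ₀ * C < γ := by
    refine (Filter.Eventually.and ?_ ?_).and ?_
    · have hc : Continuous fun T : ℝ => T * κ₀ := by fun_prop
      exact hc.continuousAt.eventually_lt continuousAt_const (by norm_num : (fun T : ℝ => T * κ₀) 0 < 1 / 2)
    · have hc : Continuous fun T : ℝ => T * κc := by fun_prop
      exact hc.continuousAt.eventually_lt continuousAt_const (by norm_num : (fun T : ℝ => T * κc) 0 < 1 / 2)
    · have hc : Continuous fun T : ℝ => 4 * T * κ₀ * C := by fun_prop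
      exact hc.continuousAt.eventually_lt continuousAt_const (by simpa using hγ : (fun T : ℝ => 4 * T * κ₀ * C) 0 < γ)
  obtain ⟨T, hT0, -, ⟨h1, h2⟩, h3⟩ := exists_pos_le_one_of_eventually hev
  exact ⟨T, hT0, h1.le, h2.le, h3.le⟩

/-- **`conv_effFormPert_small` — THE PACKAGED END: A POSITIVE COUPLING RADIUS EXISTS** [our proof] (`d ≥ 3`, `L ≥ 2`, `a > 0`, `μ ≠ ν`, even cubic volumes): for every `α, β ≥ 0`
there is `T > 0` (from `(d, a, α, β)`) such that for every volume-indexed family of Lipschitz backgrounds `(α, β)` with EL₁, every `‖u‖ ≤ T` and every `a″`, §4's END holds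
(for `α < 0` or `β < 0` the class is empty and the statement vacuous).
[cite: Balaban1987RG1, (1.21)–(1.22) p.264 (shapes)] -/
theorem conv_effFormPert_small (hL : 2 ≤ L) (hd : 3 ≤ d) {μ ν : Fin d} (hne : μ ≠ ν) (α β : ℝ) :
    ∃ T : ℝ, 0 < T ∧ ∀ {V : (t : ℕ) → (k : ℕ) → Fin d → (idx L (cubic d (evenPeriod t)) k → ℂ)}, (∀ t, LipschitzBackground L (cubic d (evenPeriod t)) (V t) α β) →
      (∀ k (μ f : Fin d) (z : Fin d → ℤ), ∃ s : ℂ, Tendsto (fun t => V t k μ (castT (cubic d (lev L k * evenPeriod t)) z, f)) atTop (𝓝 s)) →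
      ∀ (u : ℂ), ‖u‖ ≤ T → ∀ (a'' : ℂ),
    ∃ δ₀ B B' : ℝ, 0 < δ₀ ∧ 0 ≤ B ∧ 0 ≤ B' ∧ ∃ Pinf : ℕ → B12Beta.Kernel d,
      (∀ k, IsInfiniteVolumeLimit evenPeriod
        (fun t μ' ν' (z : Site d (evenPeriod t)) => (((avgTow (QBlev L (cubic d (evenPeriod t))) ((L : ℝ) ^ d)
            (fun k' => (calDalev L (cubic d (evenPeriod t)) a ha k' + u • Pmodel L (cubic d (evenPeriod t)) (V t) k')⁻¹) k)⁻¹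
            - a'' • (1 : Matrix (idx L (cubic d (evenPeriod t)) 0) (idx L (cubic d (evenPeriod t)) 0) ℂ))
          ((unitIdx L (cubic d (evenPeriod t))).symm (z, μ')) ((unitIdx L (cubic d (evenPeriod t))).symm (0, ν'))).re) (Pinf k)) ∧
      Beta.LimitRate.UniformDecay Pinf μ ν B (δ₀ / d) ∧ StepRate Pinf μ ν B' (δ₀ / d) (Real.sqrt ((L : ℝ)⁻¹)) ∧
      (∃ K : KernelInputs d Pinf, K.θ = Real.sqrt ((L : ℝ)⁻¹) ∧ K.c₀ = betaPrime510 d (B' / (1 - Real.sqrt ((L : ℝ)⁻¹))) (δ₀ / d) ∧ K.Pinf = limKernelOf Pinf ∧ K.μ = μ ∧ K.ν = ν) ∧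
      (∀ k, |B12Beta.secondMoment (Pinf k) μ ν - B12Beta.secondMoment (limKernelOf Pinf) μ ν|
          ≤ betaPrime510 d (B' / (1 - Real.sqrt ((L : ℝ)⁻¹))) (δ₀ / d) * Real.sqrt ((L : ℝ)⁻¹) ^ k) := by
  obtain ⟨κ, hκ0, -, hγ', hδ', hJA⟩ := exists_admissible_rate d a
  obtain ⟨T, hT, hT₁, hT₂, hT₃⟩ := exists_couplingRadius (κ₀ := d * (α + β) * Cst d a)
    (κc := d * (α * G2 d a (max (JA d a 1 κ 1) 0) (gamD d a - max (JA d a 1 κ 1) 0) κ)) (C := Cst d a) (gammaB_pos (d := d) a ha)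
  refine ⟨T, hT, fun hV hV1 u hu a'' => ?_⟩
  exact conv_effFormPert_of_tendsto_background L a ha hL hd hne one_pos hκ0 hγ' hδ' hJA hT.le hT₁ hT₂
    (by simpa [mul_assoc] using hT₃) hV hV1 hu a''


/-! ## §2 The one-loop bubble with background `Σ_k(u) ⊙ Σ_k(u)ᵀ` on `ℤ^d` -/

/-- **`conv_bubble_effFormPert_of_tendsto_background` — THE ONE-LOOP BUBBLE WITH BACKGROUND ON `ℤ^d`, MODULO ONLY THE BACKGROUND's POINTWISE LIMIT** [our proof] (hypotheses of
PART 152's END): the Hadamard bubble `Σ_k(u) ⊙ Σ_k(u)ᵀ` has `δ₀ > 0`, `B, B′ ≥ 0`, limit kernels `Π_k` (`IsInfiniteVolumeLimit`), `UniformDecay Π μ ν B (δ₀∕d)`, `StepRate Π μ ν B′ (δ₀∕d) (√(L⁻¹))`,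
`KernelInputs d Π`, `|secondMoment (Π k) μ ν − secondMoment Π_∞ μ ν| ≤ β′_d(B′∕(1−√(L⁻¹)), δ₀∕d)·(√(L⁻¹))^k` — PART 130's Hadamard ∕ transpose closure on PART 129's (UD)+(SR), PART 152's EL₂,
PART 140's generic END: the diagram algebra of PARTs 140–141 carries over to `U ≠ 1`. [cite: Balaban1987RG1, (1.21)–(1.22) p.264 (shapes)] -/
theorem conv_bubble_effFormPert_of_tendsto_background (hL : 2 ≤ L) (hd : 3 ≤ d) {μ ν : Fin d} (hne : μ ≠ ν) {α β a' κ T : ℝ} (ha' : 0 < a') (hκ0 : 0 < κ)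
    (hγ' : Jfree d a' κ 1 < gammaPs d a') (hδ' : deltaK d a' κ 1 < sigma0 d a' ^ 2) (hJA : JA d a a' κ 1 < gamD d a) (hT0 : 0 ≤ T)
    (hT₁ : T * (d * (α + β) * Cst d a) ≤ 1 / 2)
    (hT₂ : T * (d * (α * G2 d a (max (JA d a a' κ 1) 0) (gamD d a - max (JA d a a' κ 1) 0) κ)) ≤ 1 / 2)
    (hT₃ : 4 * T * (d * (α + β) * Cst d a) * Cst d a ≤ gammaB d a)
    {V : (t : ℕ) → (k : ℕ) → Fin d → (idx L (cubic d (evenPeriod t)) k → ℂ)} (hV : ∀ t, LipschitzBackground L (cubic d (evenPeriod t)) (V t) α β)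
    (hV1 : ∀ k (μ f : Fin d) (z : Fin d → ℤ), ∃ s : ℂ, Tendsto (fun t => V t k μ (castT (cubic d (lev L k * evenPeriod t)) z, f)) atTop (𝓝 s))
    {u : ℂ} (hu : ‖u‖ ≤ T) (a'' : ℂ) :
    ∃ δ₀ B B' : ℝ, 0 < δ₀ ∧ 0 ≤ B ∧ 0 ≤ B' ∧ ∃ Pinf : ℕ → B12Beta.Kernel d,
      (∀ k, IsInfiniteVolumeLimit evenPeriod
        (fun t μ' ν' (z : Site d (evenPeriod t)) =>
          ((((avgTow (QBlev L (cubic d (evenPeriod t))) ((L : ℝ) ^ d)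
              (fun k' => (calDalev L (cubic d (evenPeriod t)) a ha k' + u • Pmodel L (cubic d (evenPeriod t)) (V t) k')⁻¹) k)⁻¹
              - a'' • (1 : Matrix (idx L (cubic d (evenPeriod t)) 0) (idx L (cubic d (evenPeriod t)) 0) ℂ)) ⊙
            (((avgTow (QBlev L (cubic d (evenPeriod t))) ((L : ℝ) ^ d)
              (fun k' => (calDalev L (cubic d (evenPeriod t)) a ha k' + u • Pmodel L (cubic d (evenPeriod t)) (V t) k')⁻¹) k)⁻¹
              - a'' • (1 : Matrix (idx L (cubic d (evenPeriod t)) 0) (idx L (cubic d (evenPeriod t)) 0) ℂ))ᵀ))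
          ((unitIdx L (cubic d (evenPeriod t))).symm (z, μ')) ((unitIdx L (cubic d (evenPeriod t))).symm (0, ν'))).re) (Pinf k)) ∧
      Beta.LimitRate.UniformDecay Pinf μ ν B (δ₀ / d) ∧ StepRate Pinf μ ν B' (δ₀ / d) (Real.sqrt ((L : ℝ)⁻¹)) ∧
      (∃ K : KernelInputs d Pinf, K.θ = Real.sqrt ((L : ℝ)⁻¹) ∧ K.c₀ = betaPrime510 d (B' / (1 - Real.sqrt ((L : ℝ)⁻¹))) (δ₀ / d) ∧ K.Pinf = limKernelOf Pinf ∧ K.μ = μ ∧ K.ν = ν) ∧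
      (∀ k, |B12Beta.secondMoment (Pinf k) μ ν - B12Beta.secondMoment (limKernelOf Pinf) μ ν|
          ≤ betaPrime510 d (B' / (1 - Real.sqrt ((L : ℝ)⁻¹))) (δ₀ / d) * Real.sqrt ((L : ℝ)⁻¹) ^ k) := by
  have hd1 : 1 ≤ d := le_trans (by norm_num) hd
  have hd2 : 2 ≤ d := le_trans (by norm_num) hd
  have hαβ : 0 ≤ α ∧ 0 ≤ β := (hV 0).nonneg
  have hL1 : (1 : ℝ) < L := by exact_mod_cast (lt_of_lt_of_le one_lt_two hL : 1 < L)
  have hθ0 : 0 ≤ Real.sqrt ((L : ℝ)⁻¹) := Real.sqrt_nonneg _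
  have hθ1 : Real.sqrt ((L : ℝ)⁻¹) < 1 := by
    rw [show (1 : ℝ) = Real.sqrt 1 from Real.sqrt_one.symm]
    exact Real.sqrt_lt_sqrt (inv_nonneg.mpr (Nat.cast_nonneg _)) (inv_lt_one_of_one_lt₀ hL1)
  obtain ⟨κ₁, B₁, hκ₁, hB₁, hud⟩ := exists_decay_inv_pertCov_QB L a ha hd2 hαβ ha' hκ0 hγ' hδ' hJA hT0 hT₁ hT₂ hT₃
  obtain ⟨κ₂, B₂, hκ₂, hsr⟩ := twoLevelDecayRate_effForm_perturbed L a ha hL hd2 hαβ ha' hκ0 hγ' hδ' hJA hT0 hT₁ hT₂ hT₃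
  have hB₂ : 0 ≤ B₂ := by
    have x : idx L (cubic d (evenPeriod 0)) 0 := ((fun _ => 0), ⟨0, hd1⟩)
    have h := hsr (cubic d (evenPeriod 0)) (V 0) (hV 0) u hu a'' 0 x x
    rw [pow_zero, mul_one, distK_self, mul_zero, neg_zero, Real.exp_zero, mul_one] at h
    exact (norm_nonneg _).trans h
  set δ₀ : ℝ := min κ₁ (κ₂ / 2) with hδ₀
  have hδ₀0 : 0 < δ₀ := lt_min hκ₁ (half_pos hκ₂)
  -- (UD)+(SR) of `Σ_k(u)` at the common rate, on every volume
  have hudS : ∀ t k, EntryDecay (distK L (cubic d (evenPeriod t)))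
      ((avgTow (QBlev L (cubic d (evenPeriod t))) ((L : ℝ) ^ d)
          (fun k' => (calDalev L (cubic d (evenPeriod t)) a ha k' + u • Pmodel L (cubic d (evenPeriod t)) (V t) k')⁻¹) k)⁻¹
        - a'' • (1 : Matrix (idx L (cubic d (evenPeriod t)) 0) (idx L (cubic d (evenPeriod t)) 0) ℂ)) (B₁ + ‖a''‖ * 1) δ₀ := fun t k =>
    entryDecay_sub (entryDecay_of_le_rate (distK_nonneg L (cubic d (evenPeriod t))) (hud (cubic d (evenPeriod t)) (V t) (hV t) u hu k) hB₁.le (min_le_left _ _))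
      (entryDecay_smul (entryDecay_one (distK_self L (cubic d (evenPeriod t))) δ₀) a'')
  have hsrS : ∀ t, TwoLevelDecayRate (distK L (cubic d (evenPeriod t)))
      (fun k => (avgTow (QBlev L (cubic d (evenPeriod t))) ((L : ℝ) ^ d)
          (fun k' => (calDalev L (cubic d (evenPeriod t)) a ha k' + u • Pmodel L (cubic d (evenPeriod t)) (V t) k')⁻¹) k)⁻¹
        - a'' • (1 : Matrix (idx L (cubic d (evenPeriod t)) 0) (idx L (cubic d (evenPeriod t)) 0) ℂ)) B₂ δ₀ (Real.sqrt ((L : ℝ)⁻¹)) := fun t =>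
    twoLevelDecayRate_of_le_rate (distK_nonneg L (cubic d (evenPeriod t))) (hsr (cubic d (evenPeriod t)) (V t) (hV t) u hu a'') hB₂ hθ0
      ((min_le_right _ _).trans (le_of_eq rfl))
  refine ⟨δ₀ + δ₀, (B₁ + ‖a''‖ * 1) * (B₁ + ‖a''‖ * 1), B₂ * (B₁ + ‖a''‖ * 1) + (B₁ + ‖a''‖ * 1) * B₂, add_pos hδ₀0 hδ₀0, by positivity, by positivity, ?_⟩
  refine conv_of_decay_of_tendsto L hd1 tendsto_evenPeriod (add_pos hδ₀0 hδ₀0) hθ0 hθ1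
    (fun t k => entryDecay_hadamard (hudS t k) (entryDecay_transpose (distK_comm L (cubic d (evenPeriod t))) (hudS t k)))
    (fun t => twoLevelDecayRate_hadamard (hudS t) (fun k => entryDecay_transpose (distK_comm L (cubic d (evenPeriod t))) (hudS t k)) (hsrS t)
      (twoLevelDecayRate_transpose (distK_comm L (cubic d (evenPeriod t))) (hsrS t))) ?_ hne
  intro k μ' ν' z
  obtain ⟨s₁, hs₁⟩ := tendsto_effFormPert_pair L a ha hd ha' hκ0 hγ' hδ' hJA hT₁ hT₂ hT₃ k hV (hV1 k) hu a'' μ' ν' z 0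
  obtain ⟨s₂, hs₂⟩ := tendsto_effFormPert_pair L a ha hd ha' hκ0 hγ' hδ' hJA hT₁ hT₂ hT₃ k hV (hV1 k) hu a'' ν' μ' 0 z
  refine ⟨s₁ * s₂, ?_⟩
  have e0 : ∀ t, castT (cubic d (evenPeriod t)) (0 : Fin d → ℤ) = 0 := fun t => by funext i; simp [castT]
  simp only [e0] at hs₁ hs₂
  simp only [Matrix.hadamard_apply, Matrix.transpose_apply]
  exact hs₁.mul hs₂

end Summit.QuantumFields.BalabanUV.Beta.GAN24.PerturbedEffectiveFormVolumeLimitInstances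

end
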